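import Summits.HubbardSuperconductivity.HubbardSuperconductivity.Theorems.AnisotropyChordTransferFibre3FinXBCover

/-!
# Route `AnisotropyChord` / H0 rotor rung: FIN exact-block row-`N₁` certificate at `L = 12` — cell facts, part `g`

Kernel facts `xbCellAny 12 (49/50) la lb c = true` (`decide +kernel`, zero data) for 9 λ-cells of the per-`L` cover
(`…FinXBCover.xbCheck`; cell design: p3 g5 scratch `xb_design.py`, float mirror `xb_mirror.py`); assembled in `…FinXBTwelve`.
Prover seat `hubbard-h0-rotor-p3` g5; helper for piece A = stmt-HubbardSuperconductivity-23918 of rung 19089 (`--supports`, helper class).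
WHAT THIS IS NOT: nothing here proves superconductivity in the Hubbard model (rotor TARGET as worded stays FALSE, g15 verdict); kernel facts for the FIN certificate of ONE hypothesis (row `N₁`) of ONE conditional reduction.  Tree imports only; no sorry, no new axioms.
-/

namespace Summit.HubbardSuperconductivity.HubbardSuperconductivity.Theorems.AnisotropyChord.Transfer.Fibre3

namespace FinXB

set_option maxHeartbeats 4000000 in
/-- kernel fact: cell 67 at `L = 12` (certified, c = (9/20 : ℚ)). [folklore] -/
theorem xb12_67 : xbCellAny 12 (49/50 : ℚ) 8367681327811390 8869742207480075 (9/20 : ℚ) = true := by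
  decide +kernel

set_option maxHeartbeats 4000000 in
/-- kernel fact: cell 68 at `L = 12` (certified, c = (9/20 : ℚ)). [folklore] -/
theorem xb12_68 : xbCellAny 12 (49/50 : ℚ) 8869742207480075 9401926739928881 (9/20 : ℚ) = true := by
  decide +kernel

set_option maxHeartbeats 4000000 in
/-- kernel fact: cell 69 at `L = 12` (certified, c = (9/20 : ℚ)). [folklore] -/
theorem xb12_69 : xbCellAny 12 (49/50 : ℚ) 9401926739928881 9966042344324615 (9/20 : ℚ) = true := by
  decide +kernel

set_option maxHeartbeats 4000000 in
/-- kernel fact: cell 70 at `L = 12` (certified, c = (9/20 : ℚ)). [folklore] -/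
theorem xb12_70 : xbCellAny 12 (49/50 : ℚ) 9966042344324615 10564004884984095 (9/20 : ℚ) = true := by
  decide +kernel

set_option maxHeartbeats 4000000 in
/-- kernel fact: cell 71 at `L = 12` (certified, c = (9/20 : ℚ)). [folklore] -/
theorem xb12_71 : xbCellAny 12 (49/50 : ℚ) 10564004884984095 11197845178083143 (9/20 : ℚ) = true := by
  decide +kernel

set_option maxHeartbeats 4000000 in
/-- kernel fact: cell 72 at `L = 12` (certified, c = (9/20 : ℚ)). [folklore] -/
theorem xb12_72 : xbCellAny 12 (49/50 : ℚ) 11197845178083143 11869715888768135 (9/20 : ℚ) = true := by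
  decide +kernel

set_option maxHeartbeats 4000000 in
/-- kernel fact: cell 73 at `L = 12` (certified, c = (9/20 : ℚ)). [folklore] -/
theorem xb12_73 : xbCellAny 12 (49/50 : ℚ) 11869715888768135 12581898842094225 (9/20 : ℚ) = true := by
  decide +kernel

set_option maxHeartbeats 4000000 in
/-- kernel fact: cell 74 at `L = 12` (certified, c = (9/20 : ℚ)). [folklore] -/
theorem xb12_74 : xbCellAny 12 (49/50 : ℚ) 12581898842094225 13336812772619879 (9/20 : ℚ) = true := by
  decide +kernel

set_option maxHeartbeats 4000000 in
/-- kernel fact: cell 75 at `L = 12` (certified, c = (9/20 : ℚ)). [folklore] -/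
theorem xb12_75 : xbCellAny 12 (49/50 : ℚ) 13336812772619879 14137021538977075 (9/20 : ℚ) = true := by
  decide +kernel

end FinXB

end Summit.HubbardSuperconductivity.HubbardSuperconductivity.Theorems.AnisotropyChord.Transfer.Fibre3
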